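import Literature.NumberTheory.Automorphic.HarishChandraLeviIntegralReal
import Literature.NumberTheory.Automorphic.ConstantTermBlockGLParabolic
import HarnessLib

/-!
# The Levi subgroup `GL_k × GL_l ≤ GL_{k+l}` of the standard maximal parabolic: the block diagonal
# embedding over a commutative ring, over the adeles and over `K_∞`
(Borel–Jacquet 1979, 4.4; Moeglin–Waldspurger 1995, I.1.4, I.2.6)

Topic `NumberTheory/Automorphic`. For the maximal standard parabolic `P_k` of `GL_{k+l}`
(block upper triangular matrices for the labelling `maximalParabolicLabel (k + l) k`; unipotent
radical `N_k = 1 + 𝔫_k`, `blockNilpotent`/`unipotentOfBlock` of `GLnCuspidalSpectrum`) the Levi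
subgroup is `M_k = GL_k × GL_l`, embedded block diagonally. This file provides that embedding as a
group homomorphism `leviGL R k l : GL_k(R) × GL_l(R) →* GL_{k+l}(R)` over any commutative ring —
the underlying matrix is `HCLevi.blockDiag' R a d = diag(a, d)` of `HarishChandraLeviIntegralReal`
(indexing `Fin (k + l)` by `Fin.castAdd`, `Fin.natAdd`), so that its differential at the
archimedean places is the block embedding `inclLeftR`, `inclRightR` of the Levi Lie algebra used
by Harish-Chandra's transfer `Z(𝔤) → Z(𝔪)` — together with the compatibilities needed to regard
constant terms of automorphic forms on `GL_{k+l}(𝔸_K)` as functions on `GL_k(𝔸_K) × GL_l(𝔸_K)`: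

* `leviGL`, `coe_leviGL`, entry lemmas, `leviGL_injective`, `continuous_leviGL`;
* `leviGL_mem_standardParabolicGL` — `M_k ≤ P_k`;
* `leviGL_map` — naturality in the ring (`GL_n(f)`), whence over the adeles of a number field `K`:
  `GLn.fstHom_leviGL`, `GLn.sndHom_leviGL`, `GLn.toMixed_leviGL`, **`GLn.ofInfinite_leviGL`**
  (`(diag(a, d), 1) = diag((a, 1), (d, 1))`), **`GLn.ofFinite_leviGL`**, and
  `leviGL_toAdelic` / `leviGL_toAdelic_mem_arithmeticSubgroup` (rational Levi elements are rational,
  and lie in `P_k(K)`: `leviGL_rational_mem_standardParabolicGL`);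
* `leviGL_mem_Kinf` — `K_∞^{(k)} × K_∞^{(l)} ≤ K_∞^{(k+l)}` (`diag` of unitary matrices is unitary);
* `leviGL_inl_comm_inr` — the two factors commute.

Everything here is proved; the only definition is `leviGL`.

## References

* A. Borel, H. Jacquet, *Automorphic forms and automorphic representations*, Proc. Sympos. Pure
  Math. 33 (1979), Part 1, 4.4 [BorelJacquet1979].
* C. Moeglin, J.-L. Waldspurger, *Spectral decomposition and Eisenstein series* (1995), I.1.4,
  I.2.6 [MoeglinWaldspurger1995].
-/

noncomputable section

open scoped Matrix MatrixGroups Classical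
open NumberField IsDedekindDomain

namespace Literature.NumberTheory.Automorphic

/-! ### 1. Block diagonal matrices: complements to `HCLevi.blockDiag'` -/

namespace HCLevi

section BlockDiag

variable {R : Type*} [CommRing R] {k l : ℕ}

/-- `diag(1, 1) = 1`. [folklore] -/
@[simp]
theorem blockDiag'_one : blockDiag' R (1 : Matrix (Fin k) (Fin k) R) (1 : Matrix (Fin l) (Fin l) R) = 1 := by
  simp [blockDiag', Matrix.fromBlocks_one]

/-- `diag(0, 0) = 0`. [folklore] -/
@[simp]
theorem blockDiag'_zero : blockDiag' R (0 : Matrix (Fin k) (Fin k) R) (0 : Matrix (Fin l) (Fin l) R) = 0 := by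
  simp [blockDiag', Matrix.fromBlocks_zero]

/-- Entrywise maps commute with `diag` (for maps killing `0`). [folklore] -/
theorem blockDiag'_map {S : Type*} [CommRing S] (f : R → S) (hf : f 0 = 0) (X : Matrix (Fin k) (Fin k) R)
    (Y : Matrix (Fin l) (Fin l) R) : (blockDiag' R X Y).map f = blockDiag' S (X.map f) (Y.map f) := by
  ext i j
  rw [Matrix.map_apply]
  induction i using Fin.addCases with
  | left a =>
    induction j using Fin.addCases with
    | left b => rw [blockDiag'_castAdd_castAdd, blockDiag'_castAdd_castAdd, Matrix.map_apply]
    | right b => rw [blockDiag'_castAdd_natAdd, blockDiag'_castAdd_natAdd, hf]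
  | right a =>
    induction j using Fin.addCases with
    | left b => rw [blockDiag'_natAdd_castAdd, blockDiag'_natAdd_castAdd, hf]
    | right b => rw [blockDiag'_natAdd_natAdd, blockDiag'_natAdd_natAdd, Matrix.map_apply]

/-- `diag` is injective. [folklore] -/
theorem blockDiag'_injective {X X' : Matrix (Fin k) (Fin k) R} {Y Y' : Matrix (Fin l) (Fin l) R}
    (h : blockDiag' R X Y = blockDiag' R X' Y') : X = X' ∧ Y = Y' := by
  refine ⟨Matrix.ext fun a b => ?_, Matrix.ext fun a b => ?_⟩
  · have := congrFun (congrFun h (Fin.castAdd l a)) (Fin.castAdd l b)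
    rwa [blockDiag'_castAdd_castAdd, blockDiag'_castAdd_castAdd] at this
  · have := congrFun (congrFun h (Fin.natAdd k a)) (Fin.natAdd k b)
    rwa [blockDiag'_natAdd_natAdd, blockDiag'_natAdd_natAdd] at this

/-- The conjugate transpose of `diag(X, Y)` is `diag(Xᴴ, Yᴴ)`. [folklore] -/
theorem blockDiag'_conjTranspose [StarRing R] (X : Matrix (Fin k) (Fin k) R) (Y : Matrix (Fin l) (Fin l) R) :
    (blockDiag' R X Y)ᴴ = blockDiag' R Xᴴ Yᴴ := by
  ext i j
  rw [Matrix.conjTranspose_apply]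
  induction i using Fin.addCases with
  | left a =>
    induction j using Fin.addCases with
    | left b => rw [blockDiag'_castAdd_castAdd, blockDiag'_castAdd_castAdd, Matrix.conjTranspose_apply]
    | right b => rw [blockDiag'_castAdd_natAdd, blockDiag'_natAdd_castAdd, star_zero]
  | right a =>
    induction j using Fin.addCases with
    | left b => rw [blockDiag'_natAdd_castAdd, blockDiag'_castAdd_natAdd, star_zero]
    | right b => rw [blockDiag'_natAdd_natAdd, blockDiag'_natAdd_natAdd, Matrix.conjTranspose_apply]

/-- `diag` is continuous over a topological ring. [folklore] -/
theorem continuous_blockDiag' [TopologicalSpace R] :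
    Continuous fun p : Matrix (Fin k) (Fin k) R × Matrix (Fin l) (Fin l) R => blockDiag' R p.1 p.2 := by
  refine continuous_matrix fun i j => ?_
  induction i using Fin.addCases with
  | left a =>
    induction j using Fin.addCases with
    | left b =>
      simp_rw [blockDiag'_castAdd_castAdd]
      exact (continuous_apply_apply a b).comp continuous_fst
    | right b =>
      simp_rw [blockDiag'_castAdd_natAdd]
      exact continuous_const
  | right a =>
    induction j using Fin.addCases with
    | left b =>
      simp_rw [blockDiag'_natAdd_castAdd]
      exact continuous_const
    | right b =>
      simp_rw [blockDiag'_natAdd_natAdd]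
      exact (continuous_apply_apply a b).comp continuous_snd

end BlockDiag

end HCLevi

/-! ### 2. The Levi embedding `GL_k × GL_l →* GL_{k+l}` -/

section Levi

open HCLevi

variable (R : Type*) [CommRing R] (k l : ℕ)

/-- **The Levi subgroup of the maximal parabolic `P_k ≤ GL_{k+l}`**: the block diagonal embedding
`(a, d) ↦ diag(a, d) : GL_k(R) × GL_l(R) →* GL_{k+l}(R)`. Borel–Jacquet 1979, 4.4;
Moeglin–Waldspurger 1995, I.1.4. [cite: MoeglinWaldspurger1995, I.1.4] -/
def leviGL : GL (Fin k) R × GL (Fin l) R →* GL (Fin (k + l)) R where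
  toFun p :=
    { val := blockDiag' R (p.1 : Matrix (Fin k) (Fin k) R) (p.2 : Matrix (Fin l) (Fin l) R)
      inv := blockDiag' R ((p.1⁻¹ : GL (Fin k) R) : Matrix (Fin k) (Fin k) R)
        ((p.2⁻¹ : GL (Fin l) R) : Matrix (Fin l) (Fin l) R)
      val_inv := by rw [blockDiag'_mul, ← Units.val_mul, ← Units.val_mul, mul_inv_cancel, mul_inv_cancel,
        Units.val_one, Units.val_one, blockDiag'_one]
      inv_val := by rw [blockDiag'_mul, ← Units.val_mul, ← Units.val_mul, inv_mul_cancel, inv_mul_cancel,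
        Units.val_one, Units.val_one, blockDiag'_one] }
  map_one' := Units.ext (by simp)
  map_mul' p q := Units.ext (by simp [blockDiag'_mul])

variable {R k l}

/-- The matrix of `leviGL R k l (a, d)` is `diag(a, d)`. [folklore] -/
@[simp]
theorem coe_leviGL (p : GL (Fin k) R × GL (Fin l) R) :
    ((leviGL R k l p : GL (Fin (k + l)) R) : Matrix (Fin (k + l)) (Fin (k + l)) R) =
      blockDiag' R (p.1 : Matrix (Fin k) (Fin k) R) (p.2 : Matrix (Fin l) (Fin l) R) :=
  rfl

/-- The inverse of `leviGL R k l (a, d)` is `diag(a⁻¹, d⁻¹)` as a matrix. [folklore] -/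
theorem coe_leviGL_inv (p : GL (Fin k) R × GL (Fin l) R) :
    (((leviGL R k l p)⁻¹ : GL (Fin (k + l)) R) : Matrix (Fin (k + l)) (Fin (k + l)) R) =
      blockDiag' R ((p.1⁻¹ : GL (Fin k) R) : Matrix (Fin k) (Fin k) R)
        ((p.2⁻¹ : GL (Fin l) R) : Matrix (Fin l) (Fin l) R) :=
  rfl

/-- `leviGL` is injective. [folklore] -/
theorem leviGL_injective : Function.Injective (leviGL R k l) := by
  rintro ⟨a, d⟩ ⟨a', d'⟩ h
  have h1 := congrArg (fun g : GL (Fin (k + l)) R => (g : Matrix (Fin (k + l)) (Fin (k + l)) R)) h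
  simp only [coe_leviGL] at h1
  have h' := blockDiag'_injective h1
  exact Prod.ext (Units.ext h'.1) (Units.ext h'.2)

/-- **The Levi lies in the parabolic**: `diag(a, d) ∈ P_k` (its lower left block vanishes).
[cite: MoeglinWaldspurger1995, I.1.4] -/
theorem leviGL_mem_standardParabolicGL (p : GL (Fin k) R × GL (Fin l) R) :
    leviGL R k l p ∈ standardParabolicGL R (maximalParabolicLabel (k + l) k) := by
  intro i j hij
  rw [coe_leviGL]
  induction i using Fin.addCases with
  | left a =>
    exfalso
    have ha : maximalParabolicLabel (k + l) k (Fin.castAdd l a) = 0 :=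
      maximalParabolicLabel_of_lt (by simp)
    rw [ha] at hij
    exact (Fin.not_lt_zero _ hij).elim
  | right a =>
    induction j using Fin.addCases with
    | left b => exact blockDiag'_natAdd_castAdd _ _ a b
    | right b =>
      exfalso
      have h1 : maximalParabolicLabel (k + l) k (Fin.natAdd k a) = 1 :=
        maximalParabolicLabel_of_le (by simp)
      have h2 : maximalParabolicLabel (k + l) k (Fin.natAdd k b) = 1 :=
        maximalParabolicLabel_of_le (by simp)
      rw [h1, h2] at hij
      exact lt_irrefl _ hij

/-- **Naturality of the Levi embedding in the ring**: `GL(f) (diag(a, d)) = diag(GL(f) a, GL(f) d)`.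
[folklore] -/
theorem leviGL_map {S : Type*} [CommRing S] (f : R →+* S) (p : GL (Fin k) R × GL (Fin l) R) :
    Matrix.GeneralLinearGroup.map f (leviGL R k l p) =
      leviGL S k l (Matrix.GeneralLinearGroup.map f p.1, Matrix.GeneralLinearGroup.map f p.2) := by
  refine Units.ext ?_
  change (blockDiag' R (p.1 : Matrix (Fin k) (Fin k) R) (p.2 : Matrix (Fin l) (Fin l) R)).map f =
    blockDiag' S ((p.1 : Matrix (Fin k) (Fin k) R).map f) ((p.2 : Matrix (Fin l) (Fin l) R).map f)
  exact blockDiag'_map f (map_zero f) _ _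

/-- The two factors of the Levi commute. [folklore] -/
theorem leviGL_inl_comm_inr (a : GL (Fin k) R) (d : GL (Fin l) R) :
    leviGL R k l (a, 1) * leviGL R k l (1, d) = leviGL R k l (1, d) * leviGL R k l (a, 1) := by
  rw [← map_mul, ← map_mul, Prod.mk_mul_mk, Prod.mk_mul_mk, one_mul, mul_one, one_mul, mul_one]

/-- `diag(a, d) = diag(a, 1) · diag(1, d)`. [folklore] -/
theorem leviGL_eq_inl_mul_inr (a : GL (Fin k) R) (d : GL (Fin l) R) :
    leviGL R k l (a, d) = leviGL R k l (a, 1) * leviGL R k l (1, d) := by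
  rw [← map_mul, Prod.mk_mul_mk, mul_one, one_mul]

/-- **The Levi embedding is continuous** over a topological ring. [folklore] -/
theorem continuous_leviGL [TopologicalSpace R] [IsTopologicalRing R] : Continuous (leviGL R k l) := by
  refine Units.continuous_iff.2 ⟨?_, ?_⟩
  · exact continuous_blockDiag'.comp
      ((Units.continuous_val.comp continuous_fst).prodMk (Units.continuous_val.comp continuous_snd))
  · simp_rw [coe_leviGL_inv]
    exact continuous_blockDiag'.comp
      ((Units.continuous_coe_inv.comp continuous_fst).prodMk (Units.continuous_coe_inv.comp continuous_snd))

end Levi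

/-! ### 3. Over the adeles of a number field -/

section Adelic

open NumberField.mixedEmbedding HCLevi

variable {K : Type} [Field K] [NumberField K] {k l : ℕ}

/-- The archimedean part of `diag(a, d)` is `diag` of the archimedean parts. [folklore] -/
theorem GLn.fstHom_leviGL (p : GL (Fin k) (AdeleRing (𝓞 K) K) × GL (Fin l) (AdeleRing (𝓞 K) K)) :
    GLn.fstHom (k + l) K (leviGL (AdeleRing (𝓞 K) K) k l p) =
      leviGL (InfiniteAdeleRing K) k l (GLn.fstHom k K p.1, GLn.fstHom l K p.2) :=
  leviGL_map _ p

/-- The finite part of `diag(a, d)` is `diag` of the finite parts. [folklore] -/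
theorem GLn.sndHom_leviGL (p : GL (Fin k) (AdeleRing (𝓞 K) K) × GL (Fin l) (AdeleRing (𝓞 K) K)) :
    GLn.sndHom (k + l) K (leviGL (AdeleRing (𝓞 K) K) k l p) =
      leviGL (FiniteAdeleRing (𝓞 K) K) k l (GLn.sndHom k K p.1, GLn.sndHom l K p.2) :=
  leviGL_map _ p

omit [NumberField K] in
/-- `infiniteEquivMixed` is `GL_n` of the ring isomorphism `K_∞ ≅ mixedSpace K` (private copy of
`GLn.infiniteEquivMixed_eq_map` of `CornerTorusIwasawaData`, whose import closure is not wanted here).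
[folklore] -/
private theorem GLn.infiniteEquivMixed_eq_map' {m : ℕ} (g : GL (Fin m) (InfiniteAdeleRing K)) :
    GLn.infiniteEquivMixed m K g =
      Matrix.GeneralLinearGroup.map ((InfiniteAdeleRing.ringEquiv_mixedSpace K : InfiniteAdeleRing K ≃+* mixedSpace K) :
        InfiniteAdeleRing K →+* mixedSpace K) g :=
  Units.ext rfl

omit [NumberField K] in
/-- The inverse of `infiniteEquivMixed` is `GL_n` of the inverse ring isomorphism. [folklore] -/
private theorem GLn.infiniteEquivMixed_symm_eq_map' {m : ℕ} (g : GL (Fin m) (mixedSpace K)) :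
    (GLn.infiniteEquivMixed m K).symm g =
      Matrix.GeneralLinearGroup.map ((InfiniteAdeleRing.ringEquiv_mixedSpace K).symm :
        mixedSpace K →+* InfiniteAdeleRing K) g :=
  Units.ext rfl

/-- **The archimedean component of `diag(a, d)` is `diag` of the archimedean components.**
[folklore] -/
theorem GLn.toMixed_leviGL (p : GL (Fin k) (AdeleRing (𝓞 K) K) × GL (Fin l) (AdeleRing (𝓞 K) K)) :
    GLn.toMixed (k + l) K (leviGL (AdeleRing (𝓞 K) K) k l p) =
      leviGL (mixedSpace K) k l (GLn.toMixed k K p.1, GLn.toMixed l K p.2) := by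
  rw [GLn.toMixed_apply, GLn.fstHom_leviGL, GLn.infiniteEquivMixed_eq_map', leviGL_map,
    ← GLn.infiniteEquivMixed_eq_map', ← GLn.infiniteEquivMixed_eq_map', ← GLn.toMixed_apply,
    ← GLn.toMixed_apply]

/-- **`(diag(a, d), 1) = diag((a, 1), (d, 1))`**: the archimedean embedding commutes with the Levi
embedding. [folklore] -/
theorem GLn.ofInfinite_leviGL (a : GL (Fin k) (mixedSpace K)) (d : GL (Fin l) (mixedSpace K)) :
    GLn.ofInfinite (k + l) K (leviGL (mixedSpace K) k l (a, d)) =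
      leviGL (AdeleRing (𝓞 K) K) k l (GLn.ofInfinite k K a, GLn.ofInfinite l K d) := by
  refine GLn.ext_of_fstHom_of_sndHom ?_ ?_
  · rw [GLn.fstHom_ofInfinite, GLn.fstHom_leviGL, GLn.fstHom_ofInfinite, GLn.fstHom_ofInfinite,
      GLn.infiniteEquivMixed_symm_eq_map', GLn.infiniteEquivMixed_symm_eq_map',
      GLn.infiniteEquivMixed_symm_eq_map', leviGL_map]
  · rw [GLn.sndHom_ofInfinite, GLn.sndHom_leviGL, GLn.sndHom_ofInfinite, GLn.sndHom_ofInfinite,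
      ← Prod.one_eq_mk, map_one]

/-- **`(1, diag(a, d)) = diag((1, a), (1, d))`**: the finite embedding commutes with the Levi
embedding. [folklore] -/
theorem GLn.ofFinite_leviGL (a : GL (Fin k) (FiniteAdeleRing (𝓞 K) K)) (d : GL (Fin l) (FiniteAdeleRing (𝓞 K) K)) :
    GLn.ofFinite (k + l) K (leviGL (FiniteAdeleRing (𝓞 K) K) k l (a, d)) =
      leviGL (AdeleRing (𝓞 K) K) k l (GLn.ofFinite k K a, GLn.ofFinite l K d) := by
  refine GLn.ext_of_fstHom_of_sndHom ?_ ?_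
  · rw [GLn.fstHom_ofFinite, GLn.fstHom_leviGL, GLn.fstHom_ofFinite, GLn.fstHom_ofFinite,
      ← Prod.one_eq_mk, map_one]
  · rw [GLn.sndHom_ofFinite, GLn.sndHom_leviGL, GLn.sndHom_ofFinite, GLn.sndHom_ofFinite]

/-- **Rational Levi elements are rational**: `diag(γ₁, γ₂)` for `γᵢ ∈ GL(K)` is the adelic image
of the rational matrix `diag(γ₁, γ₂)`. [folklore] -/
theorem leviGL_toAdelic (γ₁ : GL (Fin k) K) (γ₂ : GL (Fin l) K) :
    leviGL (AdeleRing (𝓞 K) K) k l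
        (Matrix.GeneralLinearGroup.map (algebraMap K (AdeleRing (𝓞 K) K)) γ₁,
          Matrix.GeneralLinearGroup.map (algebraMap K (AdeleRing (𝓞 K) K)) γ₂) =
      Matrix.GeneralLinearGroup.map (algebraMap K (AdeleRing (𝓞 K) K)) (leviGL K k l (γ₁, γ₂)) :=
  (leviGL_map _ (γ₁, γ₂)).symm

/-- Hence rational Levi elements lie in the arithmetic subgroup `GL_{k+l}(K)` of the datum.
[folklore] -/
theorem leviGL_toAdelic_mem_arithmeticSubgroup (γ₁ : GL (Fin k) K) (γ₂ : GL (Fin l) K) :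
    leviGL (AdeleRing (𝓞 K) K) k l
        (Matrix.GeneralLinearGroup.map (algebraMap K (AdeleRing (𝓞 K) K)) γ₁,
          Matrix.GeneralLinearGroup.map (algebraMap K (AdeleRing (𝓞 K) K)) γ₂) ∈
      (AdelicGroupData.gl (k + l) K).arithmeticSubgroup :=
  ⟨leviGL K k l (γ₁, γ₂), (leviGL_toAdelic γ₁ γ₂).symm⟩

/-- **`K_∞^{(k)} × K_∞^{(l)} ≤ K_∞^{(k+l)}`**: `diag` of unitary matrices is unitary. [folklore] -/
theorem leviGL_mem_Kinf {a : GL (Fin k) (mixedSpace K)} {d : GL (Fin l) (mixedSpace K)}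
    (ha : a ∈ Kinf k K) (hd : d ∈ Kinf l K) : leviGL (mixedSpace K) k l (a, d) ∈ Kinf (k + l) K := by
  rw [Kinf, RealMatrixGroup.mem_maximalCompact_iff] at ha hd ⊢
  refine ⟨Subgroup.mem_top _, ?_⟩
  rw [coe_leviGL, Matrix.star_eq_conjTranspose, blockDiag'_conjTranspose, blockDiag'_mul,
    ← Matrix.star_eq_conjTranspose, ← Matrix.star_eq_conjTranspose, ha.2, hd.2, blockDiag'_one]

end Adelic

end Literature.NumberTheory.Automorphic
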